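import Mathlib.Topology.Instances.Matrix
import Mathlib.MeasureTheory.Integral.IntervalIntegral.Periodic
import Literature.Probability.LatticeModels.OnsagerToeplitz
import Literature.Probability.LatticeModels.IsingRowDeterminant
import HarnessLib

/-!
# The row two-point function is a Toeplitz determinant: discharge of `torusRowPair_tendsto_toeplitzDet`

Topic `Probability/LatticeModels`, namespace `Literature.Probability.LatticeModels`. Last step (E5)
of the exact-solution programme behind `Literature.Probability.LatticeModels.onsager_yang`: the
named fact `OnsagerToeplitz.torusRowPair_tendsto_toeplitzDet` (E. W. Montroll, R. B. Potts,
J. C. Ward, J. Math. Phys. 4 (1963) 308, §§3–4; T. D. Schultz, D. C. Mattis, E. H. Lieb, Rev. Mod.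
Phys. 36 (1964) 856, §V, eqs. (5.3)–(5.7): "the correlation function in a row … is a Toeplitz
determinant"; the formula recorded in Deift–Its–Krasovsky, CPAM 66 (2013), §4, eq. (50)) is PROVED
(`torusRowPair_tendsto_toeplitzDet_holds`), from

* `IsingRowDeterminant.limUnder_torusRowPair_eq_det` — for `β > 0`, `N = m + 3`, `k < N`:
  `lim_M ⟨σ_{(0,0)}σ_{(k,0)}⟩_{p,NM} = i^k det (G_N(i, j+1))_{i,j<k}` with the finite-`N` contractions
  `G_N(i,j) = N⁻¹ ∑_m e^{iq_m(j-i)} γ_{q_m}/sh_{q_m}` over the antiperiodic momenta `q_m = (2m+1)π/N`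
  (transfer matrix, Kaufman's rotation, the Perron–Fock vacuum and Wick's theorem: files E1–E4);

and three elementary steps proved here:

* **the symbol** (`I_mul_exp_mul_gamQ_div_shQ`): for `β > 0` and every `q`,
  `i e^{iq} γ_q/sh_q = φ_β(e^{-iq})`, where `φ_β = onsagerSymbol β` is Onsager's symbol of
  `OnsagerToeplitz` (DIK eq. (24)); indeed `γ_q = -(e^{2β}/2) i e^{-iq} w_β(-q)` with
  `w_β(θ) = (1 - γ₁e^{iθ})(1 - γ₂e^{-iθ})` (`gamQ_eq_onsagerW`, the Kramers–Wannier identities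
  `sinh 2β sinh 2β* = 1`, `cosh 2β* = coth 2β` written through `x = e^β`) and `sh_q = |γ_q|`;
* **Riemann sums on the antiperiodic grid** (`tendsto_inv_mul_sum_apMom`): for continuous `g`,
  `N⁻¹ ∑_{m<N} g(q_m) → (2π)⁻¹ ∫_0^{2π} g` (uniform continuity on `[0, 2π]`), `= (2π)⁻¹ ∫_{-π}^{π} g`
  for `2π`-periodic `g`; hence `i G_N(i, j+1) → (2π)⁻¹∫_{-π}^{π} e^{-i(j-i)θ} φ_β(e^{iθ}) dθ = φ_{j-i}`
  (`tendsto_I_mul_cylKernel`), the `(j, i)` entry of `T_k(φ_β)`;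
* **continuity of `det`** and `det Tᵀ = det T`: `i^k det(G_N(i,j+1)) = det(i G_N(i,j+1)) → D_k(φ_β)`
  (`tendsto_det_cylKernel`); finally `N = m + 3 → ∞`.

## References

* E. W. Montroll, R. B. Potts, J. C. Ward, J. Math. Phys. 4 (1963) 308–322, §§3–4.
* T. D. Schultz, D. C. Mattis, E. H. Lieb, Rev. Mod. Phys. 36 (1964) 856–871, §V.
* P. Deift, A. Its, I. Krasovsky, Comm. Pure Appl. Math. 66 (2013) 1360–1438, §2 eq. (24), §4 eq. (50).
* C. J. Thompson, *Mathematical Statistical Mechanics* (1972), Appendix D.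
-/

noncomputable section

open Filter Topology Complex MeasureTheory intervalIntegral Finset
open Literature.Analysis.Toeplitz

namespace Literature.Probability.LatticeModels

/-! ### The symbol: `i e^{iq} γ_q / sh_q = φ_β(e^{-iq})` -/

section Symbol

variable {β : ℝ}

/-- `w_β(-q) = (1 - γ₁ e^{-iq})(1 - γ₂ e^{iq})`. [folklore] -/
theorem onsagerW_neg (β q : ℝ) :
    onsagerW β (-q) =
      (1 - onsagerGammaOne β * Complex.exp (-(q * I))) * (1 - onsagerGammaTwo β * Complex.exp (q * I)) := by
  rw [onsagerW]
  push_cast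
  rw [neg_mul, neg_neg]

/-- **`γ_q` is a positive multiple of `-i e^{-iq} w_β(-q)`**: for `β > 0`,
`γ_q = -(e^{2β}/2) · i e^{-iq} (1 - γ₁e^{-iq})(1 - γ₂e^{iq})` (the Kramers–Wannier identities
`sinh 2β sinh 2β* = 1`, `cosh 2β* = cosh 2β / sinh 2β` inserted in SML's `γ_q`, eqs. (3.28)–(3.30),
and DIK's `γ₁ = tanh β e^{-2β}`, `γ₂ = e^{-2β}/tanh β`, eq. (22)). [cite: SchultzMattisLieb1964, §III, eqs. (3.28)–(3.30)] -/
theorem gamQ_eq_onsagerW (hβ : 0 < β) (q : ℝ) :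
    gamQ β q = -((Real.exp (2 * β) / 2 : ℝ) : ℂ) * I * Complex.exp (-(q * I)) * onsagerW β (-q) := by
  -- everything through `x = e^β`
  set x : ℝ := Real.exp β with hx_def
  have hx0 : 0 < x := Real.exp_pos β
  have hx1 : 1 < x := Real.one_lt_exp_iff.2 hβ
  have hxne : x ≠ 0 := hx0.ne'
  have hx21 : x ^ 2 + 1 ≠ 0 := by positivity
  have hx2m1 : x ^ 2 - 1 ≠ 0 := by nlinarith
  have hx2 : Real.exp (2 * β) = x ^ 2 := by rw [two_mul, Real.exp_add, sq]
  have hc : Real.cosh β = (x ^ 2 + 1) / (2 * x) := by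
    rw [Real.cosh_eq, Real.exp_neg]
    field_simp
    ring
  have hs : Real.sinh β = (x ^ 2 - 1) / (2 * x) := by
    rw [Real.sinh_eq, Real.exp_neg]
    field_simp
    ring
  have hC : Real.cosh (2 * β) = (x ^ 4 + 1) / (2 * x ^ 2) := by
    rw [Real.cosh_eq, Real.exp_neg, hx2]
    field_simp
  have hS : Real.sinh (2 * β) = (x ^ 2 - 1) * (x ^ 2 + 1) / (2 * x ^ 2) := by
    rw [Real.sinh_eq, Real.exp_neg, hx2]
    field_simp
    ring
  have hT : Real.tanh β = (x ^ 2 - 1) / (x ^ 2 + 1) := by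
    rw [Real.tanh_eq_sinh_div_cosh, hs, hc]
    field_simp
  have hem2 : Real.exp (-2 * β) = (x ^ 2)⁻¹ := by
    rw [show (-2 : ℝ) * β = -(2 * β) by ring, Real.exp_neg, hx2]
  have hSpos : 0 < Real.sinh (2 * β) := Real.sinh_pos_iff.2 (by linarith)
  have hSC : Real.sinh (2 * β) * Real.cosh (2 * dualBeta β) = Real.cosh (2 * β) := by
    rw [cosh_two_mul_dualBeta hβ]
    field_simp
  have hS' : Real.sinh (2 * dualBeta β) = (Real.sinh (2 * β))⁻¹ := sinh_two_mul_dualBeta hβ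
  have hE2 : Complex.exp (-(2 * q * I)) = Complex.exp (-(q * I)) ^ 2 := by
    rw [sq, ← Complex.exp_add]
    ring_nf
  rw [onsagerW_neg, gamQ, onsagerGammaOne, onsagerGammaTwo, hSC, hS', hem2, hT, hC, hS, hc, hs, hx2, hE2,
    Complex.exp_neg]
  set E := Complex.exp (q * I) with hE_def
  have hE0 : E ≠ 0 := Complex.exp_ne_zero _
  have hxC : (x : ℂ) ≠ 0 := Complex.ofReal_ne_zero.2 hxne
  have hx21C : (x : ℂ) ^ 2 + 1 ≠ 0 := by exact_mod_cast hx21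
  have hx2m1C : (x : ℂ) ^ 2 - 1 ≠ 0 := by exact_mod_cast hx2m1
  push_cast
  field_simp
  ring

/-- `|γ_q| = sh_q` (`|γ_q|² = ch_q² - 1 = sh_q²`, both nonnegative). [cite: SchultzMattisLieb1964, §III, eq. (3.30)] -/
theorem norm_gamQ_eq_shQ (β q : ℝ) : ‖gamQ β q‖ = shQ β q := by
  rw [shQ, ← normSq_gamQ, Complex.normSq_eq_norm_sq, Real.sqrt_sq (norm_nonneg _)]

/-- **The integrand of the contractions is Onsager's symbol**: for `β > 0` and every `q`,
`i e^{iq} γ_q / sh_q = φ_β(e^{-iq})` with `φ_β = onsagerSymbol β` (DIK eq. (24)); both sides are the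
junk value `0` where `w_β(-q) = 0` (only possible at `β = β_c(2)`). This identifies SML's Toeplitz
symbol (§V, eq. (5.7)) with Onsager's. [cite: DeiftItsKrasovsky2013, §2, eq. (24)] -/
theorem I_mul_exp_mul_gamQ_div_shQ (hβ : 0 < β) (q : ℝ) :
    I * Complex.exp (q * I) * (gamQ β q / ((shQ β q : ℝ) : ℂ)) = onsagerSymbol β (-q) := by
  rw [← norm_gamQ_eq_shQ, gamQ_eq_onsagerW hβ, onsagerSymbol]
  set w := onsagerW β (-q) with hw_def
  set r : ℝ := Real.exp (2 * β) / 2 with hr_def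
  have hr : 0 < r := by positivity
  have hrC : (r : ℂ) ≠ 0 := Complex.ofReal_ne_zero.2 hr.ne'
  have hnorm : ‖-(r : ℂ) * I * Complex.exp (-(q * I)) * w‖ = r * ‖w‖ := by
    rw [norm_mul, norm_mul, norm_mul, norm_neg, Complex.norm_real, Real.norm_of_nonneg hr.le,
      Complex.norm_I, mul_one, show -((q : ℂ) * I) = ((-q : ℝ) : ℂ) * I by push_cast; ring,
      Complex.norm_exp_ofReal_mul_I, mul_one]
  have hEE : Complex.exp (q * I) * Complex.exp (-(q * I)) = 1 := by
    rw [← Complex.exp_add, add_neg_cancel, Complex.exp_zero]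
  have hkey : I * Complex.exp (q * I) * (-(r : ℂ) * I * Complex.exp (-(q * I)) * w) = (r : ℂ) * w := by
    have h1 : I * Complex.exp (q * I) * (-(r : ℂ) * I * Complex.exp (-(q * I)) * w) =
        -(I * I) * (Complex.exp (q * I) * Complex.exp (-(q * I))) * (r : ℂ) * w := by ring
    rw [h1, hEE, Complex.I_mul_I]
    ring
  rw [hnorm, ← mul_div_assoc, hkey, Complex.ofReal_mul, mul_div_mul_left _ _ hrC]

/-- `w_β` is continuous in the angle. [folklore] -/
theorem continuous_onsagerW (β : ℝ) : Continuous (onsagerW β) := by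
  unfold onsagerW
  fun_prop

/-- Onsager's symbol is continuous off the critical point (`w_β ≠ 0`). [cite: DeiftItsKrasovsky2013, §2, eq. (24)] -/
theorem continuous_onsagerSymbol (hβ : 0 < β) (hβc : β ≠ criticalBetaTwo) : Continuous (onsagerSymbol β) := by
  have h : onsagerSymbol β = fun θ => onsagerW β θ / ((‖onsagerW β θ‖ : ℝ) : ℂ) := rfl
  rw [h]
  exact (continuous_onsagerW β).div (Complex.continuous_ofReal.comp (continuous_onsagerW β).norm)
    fun θ => Complex.ofReal_ne_zero.2 (norm_ne_zero_iff.2 (onsagerW_ne_zero hβ hβc θ))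

end Symbol

/-! ### Riemann sums over the antiperiodic momenta -/

section Riemann

/-- **Midpoint Riemann sums of a continuous function converge**: for continuous `g : ℝ → ℂ`,
`N⁻¹ ∑_{m<N} g((2m+1)π/N) → (2π)⁻¹ ∫_0^{2π} g` as `N → ∞` (uniform continuity on `[0, 2π]`; the
points `(2m+1)π/N` are the midpoints of the cells `[2πm/N, 2π(m+1)/N]`). [folklore] -/
theorem tendsto_inv_mul_sum_midpoint {g : ℝ → ℂ} (hg : Continuous g) :
    Tendsto (fun N : ℕ => (N : ℂ)⁻¹ * ∑ m : Fin N, g ((2 * (m : ℕ) + 1) * Real.pi / N)) atTop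
      (𝓝 ((2 * Real.pi : ℂ)⁻¹ * ∫ θ in (0 : ℝ)..2 * Real.pi, g θ)) := by
  rw [Metric.tendsto_atTop]
  intro ε hε
  obtain ⟨δ, hδ, hUC⟩ := Metric.uniformContinuousOn_iff_le.1
    ((isCompact_Icc (a := (0 : ℝ)) (b := 2 * Real.pi)).uniformContinuousOn_of_continuous hg.continuousOn)
    (ε / 2) (half_pos hε)
  obtain ⟨N₀, hN₀⟩ := exists_nat_gt (Real.pi / δ)
  refine ⟨N₀, fun N hN => ?_⟩
  have hπ : 0 < Real.pi := Real.pi_pos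
  have hN₀r : Real.pi / δ < N := hN₀.trans_le (by exact_mod_cast hN)
  have hNr : (0 : ℝ) < N := lt_trans (div_pos hπ hδ) hN₀r
  have hNne : (N : ℝ) ≠ 0 := hNr.ne'
  have hNC : (N : ℂ) ≠ 0 := by exact_mod_cast hNne
  -- the mesh `h = 2π/N` and the grid `a m = m h`
  set h : ℝ := 2 * Real.pi / N with hh_def
  have hh : 0 < h := div_pos (by positivity) hNr
  have hhδ : h / 2 ≤ δ := by
    have h1 : Real.pi < N * δ := (div_lt_iff₀ hδ).1 hN₀r
    have h2 : h / 2 = Real.pi / N := by rw [hh_def]; ring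
    rw [h2, div_le_iff₀ hNr]
    linarith
  set a : ℕ → ℝ := fun m => m * h with ha_def
  have ha0 : a 0 = 0 := by simp [ha_def]
  have haN : a N = 2 * Real.pi := by
    simp only [ha_def, hh_def]
    field_simp
  have hasucc : ∀ m : ℕ, a (m + 1) - a m = h := fun m => by
    simp only [ha_def]
    push_cast
    ring
  have hale : ∀ m : ℕ, a m ≤ a (m + 1) := fun m => by linarith [hasucc m]
  have ha_nonneg : ∀ m : ℕ, 0 ≤ a m := fun m => by
    simp only [ha_def]
    positivity
  have ha_le : ∀ m : ℕ, m < N → a (m + 1) ≤ 2 * Real.pi := fun m hm => by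
    rw [← haN]
    simp only [ha_def]
    have : ((m + 1 : ℕ) : ℝ) ≤ N := by exact_mod_cast hm
    exact mul_le_mul_of_nonneg_right this hh.le
  have hmid : ∀ m : ℕ, (2 * (m : ℝ) + 1) * Real.pi / N = a m + h / 2 := fun m => by
    simp only [ha_def, hh_def]
    ring
  -- the cellwise errors
  have hcell : ∀ m : ℕ, m < N →
      ‖(h : ℂ) * g (a m + h / 2) - ∫ θ in a m..a (m + 1), g θ‖ ≤ ε / 2 * h := by
    intro m hm
    have hconst : (h : ℂ) * g (a m + h / 2) = ∫ _ in a m..a (m + 1), g (a m + h / 2) := by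
      rw [intervalIntegral.integral_const, hasucc, Complex.real_smul]
    rw [hconst, ← intervalIntegral.integral_sub intervalIntegrable_const (hg.intervalIntegrable _ _)]
    have hb := intervalIntegral.norm_integral_le_of_norm_le_const (a := a m) (b := a (m + 1))
      (C := ε / 2) (f := fun θ => g (a m + h / 2) - g θ) ?_
    · rw [hasucc, abs_of_pos hh] at hb
      exact hb
    · intro θ hθ
      rw [Set.uIoc_of_le (hale m), Set.mem_Ioc] at hθ
      have hθ1 : a m < θ := hθ.1
      have hθ2 : θ ≤ a m + h := by linarith [hθ.2, hasucc m]
      have hx : a m + h / 2 ∈ Set.Icc 0 (2 * Real.pi) :=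
        ⟨by linarith [ha_nonneg m], by linarith [ha_le m hm, hasucc m]⟩
      have hy : θ ∈ Set.Icc 0 (2 * Real.pi) :=
        ⟨by linarith [ha_nonneg m], by linarith [ha_le m hm, hasucc m]⟩
      have hd : dist (a m + h / 2) θ ≤ δ := by
        rw [Real.dist_eq]
        refine le_trans ?_ hhδ
        rw [abs_le]
        constructor <;> linarith
      have := hUC _ hx _ hy hd
      rwa [dist_eq_norm] at this
  -- the two sides as sums over the cells
  have hS : (N : ℂ)⁻¹ * ∑ m : Fin N, g ((2 * (m : ℕ) + 1) * Real.pi / N) =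
      (2 * Real.pi : ℂ)⁻¹ * ∑ m ∈ range N, (h : ℂ) * g (a m + h / 2) := by
    rw [Fin.sum_univ_eq_sum_range (fun m : ℕ => g ((2 * (m : ℝ) + 1) * Real.pi / N)) N, ← Finset.mul_sum,
      ← mul_assoc]
    have h2π : (2 * Real.pi : ℂ) ≠ 0 := by exact_mod_cast (by positivity : (2 * Real.pi : ℝ) ≠ 0)
    congr 1
    · rw [hh_def]
      push_cast
      field_simp
    · exact Finset.sum_congr rfl fun m _ => by rw [hmid]
  have hL : (∫ θ in (0 : ℝ)..2 * Real.pi, g θ) = ∑ m ∈ range N, ∫ θ in a m..a (m + 1), g θ := by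
    rw [intervalIntegral.sum_integral_adjacent_intervals fun k _ => hg.intervalIntegrable _ _, ha0, haN]
  rw [dist_eq_norm, hS, hL, Finset.mul_sum, Finset.mul_sum, ← Finset.sum_sub_distrib]
  have h2πn : ‖(2 * Real.pi : ℂ)⁻¹‖ = (2 * Real.pi)⁻¹ := by
    rw [norm_inv, show (2 * Real.pi : ℂ) = ((2 * Real.pi : ℝ) : ℂ) by push_cast; ring, Complex.norm_real,
      Real.norm_of_nonneg (by positivity)]
  calc ‖∑ m ∈ range N, ((2 * Real.pi : ℂ)⁻¹ * ((h : ℂ) * g (a m + h / 2)) -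
          (2 * Real.pi : ℂ)⁻¹ * ∫ θ in a m..a (m + 1), g θ)‖
      ≤ ∑ m ∈ range N, ‖(2 * Real.pi : ℂ)⁻¹ * ((h : ℂ) * g (a m + h / 2)) -
          (2 * Real.pi : ℂ)⁻¹ * ∫ θ in a m..a (m + 1), g θ‖ := norm_sum_le _ _
    _ ≤ ∑ _m ∈ range N, (2 * Real.pi)⁻¹ * (ε / 2 * h) := by
        refine Finset.sum_le_sum fun m hm => ?_
        rw [← mul_sub, norm_mul, h2πn]
        exact mul_le_mul_of_nonneg_left (hcell m (mem_range.1 hm)) (by positivity)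
    _ = ε / 2 := by
        rw [Finset.sum_const, card_range, nsmul_eq_mul, hh_def]
        field_simp
    _ < ε := half_lt_self hε

/-- **Riemann sums over the antiperiodic momenta**: for continuous `2π`-periodic `g : ℝ → ℂ`,
`N⁻¹ ∑_{m<N} g(q_m) → (2π)⁻¹ ∫_{-π}^{π} g(θ) dθ` as `N → ∞`, `q_m = (2m+1)π/N` (`apMom`; SML 1964, §V:
the sums over the allowed momenta become integrals in the limit of an infinite row). [cite: SchultzMattisLieb1964, §V, eqs. (5.3)–(5.7)] -/
theorem tendsto_inv_mul_sum_apMom {g : ℝ → ℂ} (hg : Continuous g) (hper : Function.Periodic g (2 * Real.pi)) :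
    Tendsto (fun N : ℕ => (N : ℂ)⁻¹ * ∑ m : Fin N, g (apMom N m)) atTop
      (𝓝 ((2 * Real.pi : ℂ)⁻¹ * ∫ θ in (-Real.pi)..Real.pi, g θ)) := by
  have h := hper.intervalIntegral_add_eq 0 (-Real.pi)
  rw [zero_add, show -Real.pi + 2 * Real.pi = Real.pi by ring] at h
  rw [← h]
  exact tendsto_inv_mul_sum_midpoint hg

end Riemann

/-! ### The contractions converge to the Fourier coefficients of Onsager's symbol -/

section Limit

variable {β : ℝ}

/-- **`i G_N(i, j+1) → φ_{j-i}`**: for `β > 0`, `β ≠ β_c(2)` and sites `i, j`,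
`i G_N(i, j+1) = N⁻¹ ∑_m e^{iq_m(j-i)} φ_β(e^{-iq_m}) → (2π)⁻¹ ∫_{-π}^{π} e^{-i(j-i)θ} φ_β(e^{iθ}) dθ`, the
Fourier coefficient `φ_{j-i} = circleCoeff (onsagerSymbol β) (j - i)` (SML 1964, §V, eqs. (5.4)–(5.7);
DIK eq. (50)). [cite: SchultzMattisLieb1964, §V, eqs. (5.3)–(5.7)] -/
theorem tendsto_I_mul_cylKernel (hβ : 0 < β) (hβc : β ≠ criticalBetaTwo) (i j : ℕ) :
    Tendsto (fun N : ℕ => I * cylKernel N β i (j + 1)) atTop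
      (𝓝 (circleCoeff (onsagerSymbol β) ((j : ℤ) - i))) := by
  set ℓ : ℤ := (j : ℤ) - i with hℓ
  -- the integrand of `φ_ℓ`, reflected
  set G : ℝ → ℂ := fun θ => Complex.exp (-((ℓ : ℂ) * θ * I)) * onsagerSymbol β θ with hG
  set g : ℝ → ℂ := fun θ => G (-θ) with hg_def
  have hφc := continuous_onsagerSymbol hβ hβc
  have hGc : Continuous G := by
    simp only [hG]
    fun_prop
  have hgc : Continuous g := hGc.comp continuous_neg
  have hper : Function.Periodic g (2 * Real.pi) := by
    intro θ
    simp only [hg_def, hG]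
    have h1 : onsagerSymbol β (-(θ + 2 * Real.pi)) = onsagerSymbol β (-θ) := by
      rw [neg_add', (onsagerSymbol_periodic β).sub_eq]
    have h2 : Complex.exp (-((ℓ : ℂ) * ((-(θ + 2 * Real.pi) : ℝ) : ℂ) * I)) =
        Complex.exp (-((ℓ : ℂ) * ((-θ : ℝ) : ℂ) * I)) := by
      rw [show -((ℓ : ℂ) * ((-(θ + 2 * Real.pi) : ℝ) : ℂ) * I) =
          -((ℓ : ℂ) * ((-θ : ℝ) : ℂ) * I) + ℓ * (2 * Real.pi * I) by push_cast; ring,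
        Complex.exp_add, Complex.exp_int_mul_two_pi_mul_I, mul_one]
    rw [h1, h2]
  -- the kernel as a Riemann sum of `g`
  have hsum : ∀ N : ℕ, I * cylKernel N β i (j + 1) = (N : ℂ)⁻¹ * ∑ m : Fin N, g (apMom N m) := by
    intro N
    rw [cylKernel, ← mul_assoc, mul_comm I, mul_assoc, Finset.mul_sum]
    refine congrArg _ (Finset.sum_congr rfl fun m _ => ?_)
    rw [ph_succ, show I * (starRingEnd ℂ (ph (apMom N m) i) * (ph (apMom N m) j * Complex.exp (apMom N m * I)) *
        (gamQ β (apMom N m) / ((shQ β (apMom N m) : ℝ) : ℂ))) =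
        (ph (apMom N m) j * starRingEnd ℂ (ph (apMom N m) i)) *
          (I * Complex.exp (apMom N m * I) * (gamQ β (apMom N m) / ((shQ β (apMom N m) : ℝ) : ℂ))) by ring,
      ph_mul_conj_ph, I_mul_exp_mul_gamQ_div_shQ hβ]
    simp only [hg_def, hG, hℓ]
    congr 1
    congr 1
    push_cast
    ring
  simp_rw [hsum]
  -- the Riemann sums converge to `(2π)⁻¹ ∫_{-π}^{π} g = (2π)⁻¹ ∫_{-π}^{π} G = φ_ℓ`
  have hlim := tendsto_inv_mul_sum_apMom hgc hper
  have hint : (∫ θ in (-Real.pi)..Real.pi, g θ) = ∫ θ in (-Real.pi)..Real.pi, G θ := by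
    simp only [hg_def]
    rw [intervalIntegral.integral_comp_neg, neg_neg]
  rw [hint] at hlim
  rw [circleCoeff]
  exact hlim

/-- **The determinant converges**: for `β > 0`, `β ≠ β_c(2)` and every `k`,
`i^k det (G_N(i, j+1))_{i,j<k} = det (i G_N(i, j+1)) → det (φ_{j-i})_{i,j<k} = det T_k(φ_β)ᵀ = D_k(φ_β)`
as `N → ∞` (entrywise convergence and continuity of `det`). [cite: SchultzMattisLieb1964, §V, eqs. (5.3)–(5.7)] -/
theorem tendsto_det_cylKernel (hβ : 0 < β) (hβc : β ≠ criticalBetaTwo) (k : ℕ) :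
    Tendsto (fun N : ℕ => I ^ k * (Matrix.of fun i j : Fin k => cylKernel N β i (j + 1)).det) atTop
      (𝓝 (toeplitzDet (circleCoeff (onsagerSymbol β)) k)) := by
  have hmat : Tendsto (fun N : ℕ => Matrix.of fun i j : Fin k => I * cylKernel N β i (j + 1)) atTop
      (𝓝 (Matrix.of fun i j : Fin k => circleCoeff (onsagerSymbol β) ((j : ℕ) - (i : ℕ) : ℤ))) := by
    refine tendsto_pi_nhds.2 fun i => tendsto_pi_nhds.2 fun j => ?_
    exact tendsto_I_mul_cylKernel hβ hβc i j
  have hdet := ((Continuous.matrix_det continuous_id).tendsto _).comp hmat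
  have h1 : ∀ N : ℕ, I ^ k * (Matrix.of fun i j : Fin k => cylKernel N β i (j + 1)).det =
      (Matrix.of fun i j : Fin k => I * cylKernel N β i (j + 1)).det := by
    intro N
    have hs : (Matrix.of fun i j : Fin k => I * cylKernel N β i (j + 1)) =
        I • Matrix.of fun i j : Fin k => cylKernel N β i (j + 1) := by
      ext i j
      simp [Matrix.smul_apply]
    rw [hs, Matrix.det_smul, Fintype.card_fin]
  have hT : (Matrix.of fun i j : Fin k => circleCoeff (onsagerSymbol β) ((j : ℕ) - (i : ℕ) : ℤ)) =
      (toeplitzMatrix (circleCoeff (onsagerSymbol β)) k).transpose := by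
    ext i j
    simp [toeplitzMatrix]
  simp_rw [h1]
  rw [toeplitzDet, ← Matrix.det_transpose, ← hT]
  exact hdet

/-- **Montroll–Potts–Ward / Schultz–Mattis–Lieb: the row two-point function of the cylinder state
converges to the Toeplitz determinant of Onsager's symbol** — the discharge of the named fact
`torusRowPair_tendsto_toeplitzDet` (MPW, J. Math. Phys. 4 (1963) 308, §§3–4; SML, Rev. Mod. Phys. 36
(1964) 856, §V, eqs. (5.3)–(5.7); DIK, CPAM 66 (2013), §4, eq. (50): `⟨σ_{1,1}σ_{1,1+n}⟩ = D_n(φ_Onsager)`):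
for `β > 0`, `β ≠ β_c(2)` and every `k`, `lim_M ⟨σ_{(0,0)}σ_{(k,0)}⟩_{p,NM} → D_k(φ_β)` as `N → ∞`.
Proof: `lim_M = i^k det(G_N(i,j+1))` for `N = m + 3 > k` (`limUnder_torusRowPair_eq_det`: transfer
matrix, Kaufman's rotation, Perron–Fock vacuum, Wick), and `tendsto_det_cylKernel`. [cite: MontrollPottsWard1963, §§3–4 (row correlation = Toeplitz determinant; = DeiftItsKrasovsky2013 §4 eq. (50))] -/
theorem torusRowPair_tendsto_toeplitzDet_holds : torusRowPair_tendsto_toeplitzDet := by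
  intro β hβ hβc k
  rw [← Filter.tendsto_add_atTop_iff_nat 3]
  refine ((tendsto_det_cylKernel hβ hβc k).comp (tendsto_add_atTop_nat 3)).congr' ?_
  filter_upwards [eventually_ge_atTop k] with m hm
  rw [Function.comp_apply]
  exact (limUnder_torusRowPair_eq_det hβ m k (by omega)).symm

end Limit

/-! ### `onsager_yang` from the two remaining analysis facts -/

/-- **`onsager_yang` from the two analysis facts** (strong Szegő; Wu's decay): with the
exact-solution input `torusRowPair_tendsto_toeplitzDet` now PROVED (`torusRowPair_tendsto_toeplitzDet_holds`),
the Onsager–Yang formula follows from `Literature.Analysis.Toeplitz.strongSzego` (Deift–Its–Krasovsky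
2013, Thm 7; Johansson 1988) and `toeplitzDet_onsagerSymbol_exp_decay` (Wu 1966) alone
(`OnsagerToeplitz.onsager_yang_of_toeplitz`). [cite: BenettinGallavottiJonaLasinioStella1973, §3 (main result)] -/
theorem onsager_yang_of_szego_of_wu (hSz : strongSzego) (hWu : toeplitzDet_onsagerSymbol_exp_decay) :
    onsager_yang :=
  onsager_yang_of_toeplitz torusRowPair_tendsto_toeplitzDet_holds hSz hWu

/-- **BGJS c) from the two analysis facts**: `criticalBeta 2 = criticalBetaTwo` (`β_c(2) = ½ log(1+√2)`,
**crit-ising.S15**) follows from strong Szegő and Wu's decay alone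
(`OnsagerToeplitz.criticalBeta_two_of_toeplitz`). [cite: BenettinGallavottiJonaLasinioStella1973, §3 c)] -/
theorem criticalBeta_two_of_szego_of_wu (hSz : strongSzego) (hWu : toeplitzDet_onsagerSymbol_exp_decay) :
    criticalBeta_two :=
  criticalBeta_two_of_toeplitz torusRowPair_tendsto_toeplitzDet_holds hSz hWu

end Literature.Probability.LatticeModels
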